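import Literature.AlgebraicGeometry.Resolution.Lipman1969RationalSurfaceSingularities
import Literature.AlgebraicGeometry.Resolution.AlterationsResolution
import Literature.AlgebraicGeometry.Resolution.RegularLocalRingsNormal
import Literature.AlgebraicGeometry.Resolution.NormalSurfaceSingularLocus
import HarnessLib

/-!
# Rational surface singularities: first consequences of Lipman's (1.1), (1.2), (4.1)

Topic: `Literature/AlgebraicGeometry/Resolution`. PROVED plumbing around the named facts of
`Resolution/Lipman1969RationalSurfaceSingularities.lean` (Lipman 1969, Def. (1.1), Prop. (1.2),
Thm. (4.1)), in the form their consumers need: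

* `subsingleton_cechH1_iff`, `subsingleton_cechH1_comp_iff`, `hasTrivialCechH1_comp_iff` — the
  Čech groups `Ȟ¹(𝒰, 𝒪_X)` of `Morphisms/CechH1` do not depend on the affine base: for
  `f : X → Spec A` and any `φ : B → A`, `Ȟ¹` computed for `f` and for `f ≫ Spec φ` vanish together
  (the cochains, cocycles and coboundaries are the same abelian groups).
* `HasRationalSingularity.of_ringEquiv` — Definition (1.1) is invariant under ring isomorphisms.
* `Lipman1969_1_2.hasTrivialCechH1_of_isResolution` — under Prop. (1.2): **every**
  desingularization `π : X → Spec R` of a two-dimensional normal Noetherian local domain with a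
  rational singularity has `H¹(X, 𝒪_X) = 0` (Prop. (1.2) 2) applied to `W = X`, which is normal,
  being regular).
* `Lipman1969_4_1.exists_isMinimalResolution_Spec` — under Thm. (4.1): such an `R` has a minimal
  desingularization `X_min → Spec R` (the singular locus of `Spec R` is at most the closed point:
  the other local rings are normal of dimension `≤ 1`, hence regular).

## References

* J. Lipman, *Rational singularities with applications to algebraic surfaces and unique
  factorization*, Publ. Math. IHÉS 36 (1969), Def. (1.1), Prop. (1.2) (p. 199), Thm. (4.1)
  (p. 204). [Lipman1969]
* The Stacks project, Tag 01ED (Čech cohomology). [StacksProject]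
-/

noncomputable section

open CategoryTheory AlgebraicGeometry TopologicalSpace IsLocalRing
open Literature.AlgebraicGeometry.Motives Literature.AlgebraicGeometry.Morphisms

universe u v

namespace Literature.AlgebraicGeometry.Resolution

/-! ## The Čech `Ȟ¹` of the structure sheaf does not depend on the affine base -/

section CechBase

variable {A B : Type u} [CommRing A] [CommRing B] {X : Scheme.{u}}

/-- The vanishing of `Ȟ¹(𝒰, 𝒪_X)` for `X` regarded over `Spec A` through `f` and over `Spec B`
through `f ≫ Spec φ` (`φ : B → A`) are equivalent: the Čech cochains, cocycles and coboundaries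
are literally the same abelian groups (only the ring of scalars changes).
[cite: StacksProject, Tag 01ED (Cohomology, Section 20.9)] -/
theorem subsingleton_cechH1_comp_iff (f : X ⟶ Spec (.of A))
    (φ : CommRingCat.of B ⟶ CommRingCat.of A) {ι : Type v} (U : ι → X.Opens) :
    Subsingleton (CechH1 (f ≫ Spec.map φ) U) ↔ Subsingleton (CechH1 f U) :=
  Iff.rfl

/-- `H¹(X, 𝒪_X) = 0` (`HasTrivialCechH1`) does not depend on the affine base over which `X` is
considered. [cite: StacksProject, Tag 01ED (Cohomology, Section 20.9)] -/
theorem hasTrivialCechH1_comp_iff (f : X ⟶ Spec (.of A))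
    (φ : CommRingCat.of B ⟶ CommRingCat.of A) :
    HasTrivialCechH1 (f ≫ Spec.map φ) ↔ HasTrivialCechH1 f := by
  unfold HasTrivialCechH1
  refine forall_congr' fun ι => forall_congr' fun _ => forall_congr' fun U =>
    forall_congr' fun _ => forall_congr' fun _ => ?_
  exact subsingleton_cechH1_comp_iff f φ U

end CechBase

/-! ## Definition (1.1) is invariant under isomorphism -/

/-- A ring isomorphic to one with a rational singularity has a rational singularity (transport
the desingularization along `Spec R ≅ Spec S`). [cite: Lipman1969, Definition (1.1) (p. 199)] -/
theorem HasRationalSingularity.of_ringEquiv {R S : Type u} [CommRing R] [CommRing S]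
    (e : R ≃+* S) (h : HasRationalSingularity R) : HasRationalSingularity S := by
  obtain ⟨X, f, hf, hH⟩ := h
  let φ : CommRingCat.of S ⟶ CommRingCat.of R := e.symm.toCommRingCatIso.hom
  haveI : IsProper f := hf.isProper
  refine ⟨X, f ≫ Spec.map φ, ⟨inferInstance, hf.isBirational.comp_iso _, hf.isRegular⟩, ?_⟩
  exact (hasTrivialCechH1_comp_iff f φ).2 hH

/-! ## Consequences of Proposition (1.2) -/

/-- The source of a resolution of singularities of an integral scheme is integral (reduced since
regular, irreducible since birational to an irreducible scheme).
[cite: Lipman1969, Section 0.3 (p. 199)] -/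
theorem IsResolution.isIntegral_source {X' X : Scheme.{u}} [IsIntegral X] {π : X' ⟶ X}
    (hπ : IsResolution π) : IsIntegral X' := by
  haveI : IsReduced X' := hπ.isRegular.isReduced
  exact hπ.isBirational.isIntegral

/-- Under **Lipman 1969, Prop. (1.2)**: every desingularization `π : X → Spec R` of a
two-dimensional normal Noetherian local domain `R` with a rational singularity has
`H¹(X, 𝒪_X) = 0` — part 2) of the proposition for `W = X` (regular, hence normal) and `g = π`
(proper birational). This is the form in which rationality is used on the *minimal* resolution.
[cite: Lipman1969, Proposition (1.2) 2) (p. 199)] -/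
theorem Lipman1969_1_2.hasTrivialCechH1_of_isResolution (h12 : Lipman1969_1_2.{u})
    {R : Type u} [CommRing R] [IsNoetherianRing R] [IsLocalRing R] [IsDomain R]
    [IsIntegrallyClosed R] (hdim : ringKrullDim R = 2) (hrat : HasRationalSingularity R)
    {X : Scheme.{u}} (π : X ⟶ Spec (.of R)) (hπ : IsResolution π) : HasTrivialCechH1 π := by
  haveI : IsProper π := hπ.isProper
  haveI : IsIntegral X := hπ.isIntegral_source
  exact (h12 R hdim hrat X π hπ.isBirational).2
    (fun x => by haveI := hπ.isRegular x; exact isIntegrallyClosed_of_isRegularLocalRing _)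
    inferInstance

/-! ## Consequences of Theorem (4.1): the minimal resolution of `Spec R` -/

/-- Under **Lipman 1969, Thm. (4.1)**: a two-dimensional normal Noetherian local domain `R` with a
rational singularity has a minimal desingularization `X_min → Spec R` (through which every
desingularization factors). Indeed `Spec R` is an integral Noetherian separated normal surface
whose only possibly singular point is the closed point (the other local rings are normal of
dimension `≤ 1` — their dimension is the height of a non-maximal prime — hence regular), and the
local ring at the closed point is `R`, a rational singularity.
[cite: Lipman1969, Theorem (4.1) (p. 204)] -/
theorem Lipman1969_4_1.exists_isMinimalResolution_Spec (h41 : Lipman1969_4_1.{u})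
    (R : Type u) [CommRing R] [IsNoetherianRing R] [IsLocalRing R] [IsDomain R]
    [IsIntegrallyClosed R] (hdim : ringKrullDim R = 2) (hrat : HasRationalSingularity R) :
    ∃ (X : Scheme.{u}) (f : X ⟶ Spec (.of R)), IsMinimalResolution f := by
  -- the local rings of `Spec R` are the localisations `R_𝔭`
  have hloc : ∀ x : Spec (.of R),
      ∃ (_ : Algebra R ((Spec (.of R)).presheaf.stalk x)),
        IsLocalization.AtPrime ((Spec (.of R)).presheaf.stalk x) x.asIdeal := fun x =>
    ⟨StructureSheaf.stalkAlgebra R x, StructureSheaf.IsLocalization.to_stalk R x⟩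
  -- normality of the local rings of `Spec R`
  have hN : ∀ x : Spec (.of R), IsIntegrallyClosed ((Spec (.of R)).presheaf.stalk x) := fun x => by
    obtain ⟨_, hx⟩ := hloc x
    exact isIntegrallyClosed_of_isLocalization _ x.asIdeal.primeCompl
      (Ideal.primeCompl_le_nonZeroDivisors x.asIdeal)
  -- dimension of `Spec R`
  have hdimS : topologicalKrullDim (Spec (.of R)) = 2 := by
    change topologicalKrullDim (PrimeSpectrum R) = 2
    rw [PrimeSpectrum.topologicalKrullDim_eq_ringKrullDim R, hdim]
  -- the height of the maximal ideal is `2`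
  have hm : (maximalIdeal R).height = 2 := by
    have h := IsLocalRing.maximalIdeal_height_eq_ringKrullDim (R := R)
    rw [hdim] at h
    exact WithBot.coe_eq_coe.mp (h.trans (WithBot.coe_ofNat 2).symm)
  -- every point other than the closed point is regular
  have hreg : ∀ x : Spec (.of R), x ≠ closedPoint R → x ∈ Scheme.regularLocus (Spec (.of R)) := by
    intro x hx
    refine mem_regularLocus_of_ringKrullDim_stalk_le_one hN ?_
    obtain ⟨_, hxl⟩ := hloc x
    rw [IsLocalization.AtPrime.ringKrullDim_eq_height x.asIdeal ((Spec (.of R)).presheaf.stalk x)]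
    have hne : x.asIdeal ≠ maximalIdeal R := fun h => hx (PrimeSpectrum.ext h)
    have hlt : x.asIdeal < maximalIdeal R :=
      lt_of_le_of_ne (IsLocalRing.le_maximalIdeal x.2.ne_top) hne
    have h1 := Ideal.height_add_one_le_of_lt_of_isPrime hlt
    rw [hm] at h1
    have h3 : x.asIdeal.height ≤ 1 := by
      cases hc : x.asIdeal.height with
      | top => rw [hc] at h1; exact absurd h1 (by decide)
      | coe n =>
        rw [hc] at h1
        have : n + 1 ≤ 2 := by exact_mod_cast h1
        exact_mod_cast (by omega : n ≤ 1)
    exact_mod_cast h3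
  have hsub : (Scheme.regularLocus (Spec (.of R)))ᶜ ⊆ {closedPoint R} := by
    intro x hx
    by_contra hne
    exact hx (hreg x hne)
  have hfin : (Scheme.regularLocus (Spec (.of R)))ᶜ.Finite := (Set.finite_singleton _).subset hsub
  -- the local ring at the closed point is `R` itself
  have hrat' : ∀ y ∈ (Scheme.regularLocus (Spec (.of R)))ᶜ,
      HasRationalSingularity ((Spec (.of R)).presheaf.stalk y) := by
    intro y hy
    obtain rfl : y = closedPoint R := Set.mem_singleton_iff.mp (hsub hy)
    obtain ⟨_, hl⟩ := hloc (closedPoint R)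
    have e : R ≃ₐ[R] (Spec (.of R)).presheaf.stalk (closedPoint R) :=
      IsLocalization.atUnits R (closedPoint R).asIdeal.primeCompl fun x hx => by
        change IsUnit x
        by_contra h
        exact hx ((IsLocalRing.mem_maximalIdeal x).mpr (mem_nonunits_iff.mpr h))
    exact hrat.of_ringEquiv e.toRingEquiv
  exact h41 (Spec (.of R)) hdimS hN hfin hrat'

end Literature.AlgebraicGeometry.Resolution

end
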